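/-
Copyright (c) 2026 the pub-hodgecm-mathlib formalisation cell (harness21).  Prover seat hodgecm-mathlib-LH4-p08 (g9), req620 Track A «(D-RAM) FOUR-FRAME» squad, helper lane
on h413 = stmt-HodgeConjecture-24833 (count-neutral).  STAGE-1b, row (2), RamM lane of the (LAW) END — dealer LH4-plan (g13) WORD #107 (R1) «the scaled top value, RamM».  2026-09-04.
-/
import Summits.HodgeConjecture.HodgeConjecture.Theorems.F0P3cDyRamToricLevelCensusRamMWeldFar          -- ★ (LH4-p06 (g5)): (S-far)∕(S-near) at `λ − u`; brings the whole ★ T5c top-cell chain (TopCellsFar∕OddFar∕HvTop∕Law∕LawPack∕Near∕Top)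
import HarnessLib

/-!
# T5c (R1): THE TOP CELLS OF THE SCALED MULTIPLIER `μ₁ = t⁻¹(λ − u)` ON TYPE RamM — ALIVE UP TO THE UNSCALED CONDUCTOR (alive offset `e`)
# `#levelSetDep_h(j,a;t⁻¹(λ−u)) = [2j + d_E ≤ 2jl₁ + 1 + e ∧ side]·2·q^{j − (j+a−m₁−s0+1)∕2}` on the FAR top cells of `μ₁`; the NEAR top cells AGREE — both parity regimes

Cell `hodgecm-mathlib` (D-0151), FLOOR 0, crux item H413 = `stmt-HodgeConjecture-24833`, route of record `HCCMUnconditional`; squad F0∕P3c∕LH4 (req618∕req620); helper lane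
`--supports stmt-HodgeConjecture-24833 --as helper` (count-neutral).  THEOREMS ONLY (no `def`, no instance, no notation, no `sorry`; default heartbeats).

THE OBJECT (dealer WORD #107 (R1); LH4-p07 (g9) SCOPE-RamM-lane v1 48fdfff2 row (R1); the RamM twin of LH4-p07 (g9)'s ★ p859867 (D3♯)-RamK).  The RamM level socket reads
a piece `lev_{a′,b′}` on the cone cells of the SCALED multiplier `μ₁ = t⁻¹(λ − u)` (`ρt = t`, `|t| = |ϖE|^e`, `e = a′`; tokens `m₁ + e = m`, `jl₁ + e = jl`).  The per-cell
facts ★ p860773 `toricCensusSum_ramM_weld_cut[_flip]_v2` (this seat) asks for are (C-1) the u-free tables (★, μ-free), (C-2GEN)∕(C-2OFF) (★ `levelSetDep_eq_of_generic_ramified`,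
μ-generic) and, on μ₁'s coincidence diagonal `j + m₁ = jl₁ + a`, (C-2TOPnear) the two literals AGREE and (C-2TOPfarE) the far cells carry the side bit with the ALIVE OFFSET
`2j + (g + s0) ≤ 2jl₁ + 1 + e`.  THIS FILE proves the two diagonal letters AT THE FRAME, in ★ `hC2TOPfar_of_letters`'s binders + the scaling letters:
* §0 `tokens_inv_mul` — `|μ₁| = |ϖE|^{m₁}`, `|μ₁ − ρμ₁| = |ϖE^{jl₁}(α − ρα)|`, and the twist is the element's own: `ρμ₁∕μ₁ = ρμ∕μ` (`t` is ρ-fixed).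
* §1 **`hC2TOPnear_of_letters_inv_mul`** — ★ p858164 `ncard_levelSetDep_top_eq_of_near` is μ-GENERIC: read at μ₁'s tokens with the class letters unchanged
  (`k₀ = m − jl − e_cls = m₁ − jl₁ − e_cls`).
* §2 **`hC2TOPfarE_of_letters_inv_mul`** — the far law at μ₁.  MECHANISM: ★ (V) `ncard_levelSetDep_top_cast_eq_of_bit` (μ-generic) leaves the literal (D3) bit
  `χ = ∃ ω₁ ∈ U, |1 + (η∕κ₁)·t(ω₁)| ≤ exp(2m₁ − 2a − 2j − d_ρ)` with `κ₁ = ρμ₁∕μ₁ = κ`, radius `exp(−(2c + d_ρ))` at the radius letter `c = j + a − m₁`; ★ bridge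
  `topBit_iff_twistNear∕anchoredNear_ramified` (μ-generic) + ★ LAWS `twistNear∕anchoredNear∕oddBit_iff_censusBit` — laws of `κ` at a FREE radius letter `c`, in the UNSCALED tokens
  `(m, jl)` — evaluate `χ` as `c + g + s0 ≤ jl + 1 ∧ (c + 2 ≤ s0 + 2g ∨ side)`; on μ₁'s diagonal `c = 2j − jl₁`, `jl = jl₁ + e`: **`2j + (g + s0) ≤ 2jl₁ + 1 + e`** and
  `j + a + 2 ≤ m₁ + s0 + 2g` (near₁).  Regime A (translator ∕ anchor classes, ★ TopCellsFar's route) and regime B (`jl + 1 = m + s0`, odd classes, ★ TopCellsOddFar's route with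
  ★ `rel_symm_of_rel` for the partner) exactly as ★ (S-far) `hC2TOPfar_of_letters` (adapted-from credit: LH4-p06 (g5)).
Conclusions = (C-2TOPnear) ∕ (C-2TOPfarE) of ★ p860773 VERBATIM at `μ := tc⁻¹ * (lam − u)`, tokens `(m₁, jl₁)`, offset `eo`.
HONEST LABEL.  Count-neutral local algebra over ★ organs; the side letters are hypotheses (the (C-5b) sign dictionary, as in ★ (C)); nothing about (ρ2b′-X) or any law is asserted;
`HC_CM` is proved only modulo the 7 printed citations (2 remaining named inputs: hLiu418 = `stmt-HodgeConjecture-24832`, h413 = `stmt-HodgeConjecture-24833`) until rung 0 closes.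

## References
* [Flicker1998UnitaryFL] Y. Z. Flicker, *Elementary proof of the fundamental lemma for a unitary group*, Canad. J. Math. 50 (1998): Prop. 7 p. 84 (the level tables).
* [Kottwitz1986BaseChangeUnits] R. E. Kottwitz, *Base change for unit elements of Hecke algebras*, Compositio Math. 60 (1986): §1 pp. 240–241 (fixed-lattice counts, tube condition).
* [Serre1979] J.-P. Serre, *Local Fields*, GTM 67 (1979): Ch. III §6 Prop. 12; Ch. V §3 Prop. 5, Cor. 3 (orders of conductor `c`; norm index on the unit filtration).
* [Jacobowitz1962] R. Jacobowitz, *Hermitian forms over local fields*, Amer. J. Math. 84 (1962): §4 (lattice classes, duals).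
-/

set_option autoImplicit false

noncomputable section

namespace Summit.HodgeConjecture.HodgeConjecture.Cruxes.H413.F0P3cDyRamToricLevelCensusRamM

open WithZero IsLocalRing
open scoped Valued
open Literature.NumberTheory.Automorphic.UnitaryThreeFourFrame (IsRamifiedQuadraticDatum)
open Literature.NumberTheory.LocalFields.QuadraticOrder Literature.NumberTheory.LocalFields.WildQuadraticDatum
open Summit.HodgeConjecture.HodgeConjecture.Cruxes.H413.F0P3cDyRamToricCensusDefs

variable {K : Type} [Field K] [Valued K ℤᵐ⁰] {ρ Θ τ : K →+* K} {α ϖE h h' : K} {dρ t dτ tτ : ℕ}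
variable {K' : Type*} [Field K'] [Valued K' ℤᵐ⁰] {σ' : K' →+* K'} {π' : K'} {d' : ℕ}

/-! ## §0 The scaled multiplier's tokens and twist -/

omit [Valued K ℤᵐ⁰] in
/-- The twist ignores a `ρ`-fixed scaling: `ρ(t⁻¹μ)∕(t⁻¹μ) = ρμ∕μ`. [cite: Serre1979, Ch. III §6 Prop. 12] -/
theorem twist_inv_mul {μ tc : K} (hρt : ρ tc = tc) (htc0 : tc ≠ 0) : ρ (tc⁻¹ * μ) / (tc⁻¹ * μ) = ρ μ / μ := by
  rw [map_mul ρ, map_inv₀, hρt, mul_div_mul_left _ _ (inv_ne_zero htc0)]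

/-- Tokens of `μ₁ = t⁻¹·μ` (`ρt = t`, `|t| = |ϖE|^e`): `|μ₁| = |ϖE|^{m₁}`, `|μ₁ − ρμ₁| = |ϖE^{jl₁}(α − ρα)|` (`m₁ + e = m`, `jl₁ + e = jl`), and `ρμ₁∕μ₁ = ρμ∕μ`.
[cite: Serre1979, Ch. III §6 Prop. 12] -/
theorem tokens_inv_mul (hϖE : Valued.v ϖE = exp (-2 : ℤ)) {μ : K} {m jl : ℕ} (hμ : Valued.v μ = Valued.v ϖE ^ m)
    (hjl : Valued.v (μ - ρ μ) = Valued.v (ϖE ^ jl * (α - ρ α))) {tc : K} (hρt : ρ tc = tc) {eo : ℕ} (hte : Valued.v tc = Valued.v ϖE ^ eo)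
    {m₁ jl₁ : ℕ} (hme : m₁ + eo = m) (hjle : jl₁ + eo = jl) :
    Valued.v (tc⁻¹ * μ) = Valued.v ϖE ^ m₁ ∧ Valued.v (tc⁻¹ * μ - ρ (tc⁻¹ * μ)) = Valued.v (ϖE ^ jl₁ * (α - ρ α)) ∧ ρ (tc⁻¹ * μ) / (tc⁻¹ * μ) = ρ μ / μ := by
  have hv0 : Valued.v ϖE ≠ 0 := by rw [hϖE]; exact exp_ne_zero
  have hpow0 : ∀ k : ℕ, Valued.v ϖE ^ k ≠ 0 := fun k => pow_ne_zero _ hv0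
  have htc0 : tc ≠ 0 := fun h0 => by rw [h0, map_zero] at hte; exact (hpow0 eo) hte.symm
  refine ⟨?_, ?_, twist_inv_mul hρt htc0⟩
  · rw [map_mul, map_inv₀, hte, hμ, ← hme, pow_add, mul_comm (Valued.v ϖE ^ m₁), inv_mul_cancel_left₀ (hpow0 eo)]
  · rw [map_mul ρ, map_inv₀, hρt, ← mul_sub, map_mul, map_inv₀, hte, hjl, ← hjle, map_mul, map_mul, map_pow, map_pow, pow_add,
      mul_assoc, mul_left_comm (Valued.v ϖE ^ jl₁), inv_mul_cancel_left₀ (hpow0 eo)]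

/-! ## §1 (C-2TOPnear) at the scaled multiplier -/

/-- **(C-2TOPnear) AT `μ₁ = t⁻¹(λ − u)`** — ★ p858164 read at μ₁'s tokens; the class letters at `(k₀, k₀′) = (m − jl − e, m − jl − e′)` are μ₁'s too (`m₁ − jl₁ = m − jl`).
[cite: Serre1979, Ch. V §3 Cor. 3] [cite: Flicker1998UnitaryFL, Prop. 7 p. 84] [cite: Jacobowitz1962, §4] -/
theorem hC2TOPnear_of_letters_inv_mul [CompleteSpace K] [IsDiscreteValuationRing 𝒪[K]] [Finite 𝓀[K]]
    (hD : IsRamifiedQuadraticDatum ρ α dρ t) (hΘρ : ∀ x, Θ (ρ x) = ρ (Θ x)) (hvΘ : ∀ x, Valued.v (Θ x) = Valued.v x)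
    (hϖE : Valued.v ϖE = exp (-2 : ℤ)) (hρϖ : ρ ϖE = ϖE) {q : ℕ} (hq : Nat.card 𝓀[K] = q)
    (hσ' : ∀ x, σ' (σ' x) = x) (hvσ' : ∀ x, Valued.v (σ' x) = Valued.v x) (hfix' : ∀ x : K', σ' x = x → x ≠ 0 → ∃ n : ℤ, Valued.v x = exp (2 * n))
    (hπ' : Valued.v π' = exp (-1 : ℤ)) (hdd' : Valued.v (π' - σ' π') = Valued.v π' ^ d')
    (jK : K' →+* K) (hjle : ∀ x y : K', Valued.v (jK x) ≤ Valued.v (jK y) ↔ Valued.v x ≤ Valued.v y) (hjΘ : ∀ x, Θ (jK x) = jK x)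
    (hjfix : ∀ z : K, Θ z = z → ∃ x, jK x = z) (hjσ : ∀ x, jK (σ' x) = ρ (jK x)) (hjπ : Valued.v (jK π') = exp (-2 : ℤ))
    {ϖ : K} {dΘ tΘ : ℕ} (hDΘ : IsRamifiedQuadraticDatum Θ ϖ dΘ tΘ)
    (hFN : ∀ f : K, ρ f = f → Θ f = f → Valued.v f = 1 → ∃ x : K, x * Θ x = f)
    {n₀ : K} (hΘn₀ : Θ n₀ = n₀) (hn₀1 : Valued.v n₀ = 1) (hn₀N : ¬ ∃ z : K, z * Θ z = n₀)
    (hh : h ≠ 0) {vh : ℤ} (hvh : Valued.v h = exp (-vh)) (hh' : h' ≠ 0) {vh' : ℤ} (hvh' : Valued.v h' = exp (-vh'))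
    {lam u : K} {m jl : ℕ} (hμ : Valued.v (lam - u) = Valued.v ϖE ^ m) (hjl : Valued.v ((lam - u) - ρ (lam - u)) = Valued.v (ϖE ^ jl * (α - ρ α)))
    {tc : K} (hρt : ρ tc = tc) {eo : ℕ} (hte : Valued.v tc = Valued.v ϖE ^ eo) {m₁ jl₁ : ℕ} (hme : m₁ + eo = m) (hjle' : jl₁ + eo = jl)
    {g s0 : ℕ} (hg : dΘ = 2 * g) (hs0 : dτ = 2 * s0) (hd' : 2 * d' = dρ + dτ)
    {e e' : ℤ} (he : vh + dρ = 2 * e) (he' : vh' + dρ = 2 * e')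
    {ω_r : Kˣ} (hω_r : Valued.v (ω_r : K) = 1)
    (hrel : ρ h' / h' * (ρ (α ^ ((m : ℤ) - jl - e') * Θ (α ^ ((m : ℤ) - jl - e'))) / (α ^ ((m : ℤ) - jl - e') * Θ (α ^ ((m : ℤ) - jl - e')))) =
      ρ h / h * (ρ (α ^ ((m : ℤ) - jl - e) * Θ (α ^ ((m : ℤ) - jl - e))) / (α ^ ((m : ℤ) - jl - e) * Θ (α ^ ((m : ℤ) - jl - e)))) * (ρ n₀ / n₀) *
        (ρ ((ω_r : K) * Θ ω_r) / ((ω_r : K) * Θ ω_r))) :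
    ∀ j a, j ≤ jl₁ → a ≤ j → ¬ (a ≤ m₁ ∧ (j + a ≤ m₁ ∨ (2 * a ≤ m₁ ∧ j + a ≤ jl₁))) → j + m₁ = jl₁ + a → j + a + 2 ≤ m₁ + s0 + 2 * g →
      (levelSetDep ρ Θ α ϖE h j a (tc⁻¹ * (lam - u))).ncard = (levelSetDep ρ Θ α ϖE h' j a (tc⁻¹ * (lam - u))).ncard := by
  intro j a hj _ hng hdiag hnear
  obtain ⟨hμ₁, hjl₁, -⟩ := tokens_inv_mul (ρ := ρ) (α := α) hϖE hμ hjl hρt hte hme hjle'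
  exact ncard_levelSetDep_top_eq_of_near hD hΘρ hvΘ hϖE hρϖ hq hσ' hvσ' hfix' hπ' hdd' jK hjle hjΘ hjfix hjσ hjπ hDΘ hFN hΘn₀ hn₀1 hn₀N hh hvh hh' hvh' hμ₁ hjl₁ hg
    (show 2 * d' = dρ + 2 * s0 by omega) (k₀ := (m : ℤ) - jl - e) (k₀' := (m : ℤ) - jl - e') (by omega) (by omega) hω_r hrel hj hng hdiag hnear

/-! ## §2 (C-2TOPfarE) at the scaled multiplier: the far law with the alive offset -/

/-- **(C-2TOPfarE) AT `μ₁ = t⁻¹(λ − u)` — THE SCALED TOP VALUE ON TYPE RamM, BOTH REGIMES.**  ★ `hC2TOPfar_of_letters`'s binders VERBATIM + the scaling letters ⊢ the far-cell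
letter of ★ p860773 `toricCensusSum_ramM_weld_cut[_flip]_v2` at `μ := tc⁻¹ * (lam − u)`, tokens `(m₁, jl₁)`, alive offset `eo` — see the module docstring for the mechanism.
[cite: Flicker1998UnitaryFL, Prop. 7 p. 84] [cite: Kottwitz1986BaseChangeUnits, §1 pp. 240–241] [cite: Serre1979, Ch. V §3 Prop. 5, Cor. 3] [cite: Jacobowitz1962, §4] -/
theorem hC2TOPfarE_of_letters_inv_mul [CompleteSpace K] [IsDiscreteValuationRing 𝒪[K]] [Finite 𝓀[K]] [IsDiscreteValuationRing 𝒪[K']] [Finite 𝓀[K']]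
    (hD : IsRamifiedQuadraticDatum ρ α dρ t) (hΘρ : ∀ x, Θ (ρ x) = ρ (Θ x)) (hvΘ : ∀ x, Valued.v (Θ x) = Valued.v x)
    (hτ : ∀ x, τ x = Θ (ρ x)) (hDτ : IsRamifiedQuadraticDatum τ α dτ tτ)
    {P : K} (hτP : τ P = P) (hP : Valued.v P = exp (-2 : ℤ)) {dK : ℕ} (hdK : Valued.v (P - ρ P) = exp (-(2 * (dK : ℤ))))
    (hσ' : ∀ x, σ' (σ' x) = x) (hvσ' : ∀ x, Valued.v (σ' x) = Valued.v x) (hfix' : ∀ x : K', σ' x = x → x ≠ 0 → ∃ n : ℤ, Valued.v x = exp (2 * n))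
    (hπ' : Valued.v π' = exp (-1 : ℤ)) (hdd' : Valued.v (π' - σ' π') = Valued.v π' ^ d')
    (jK : K' →+* K) (hjle : ∀ x y : K', Valued.v (jK x) ≤ Valued.v (jK y) ↔ Valued.v x ≤ Valued.v y) (hjΘ : ∀ x, Θ (jK x) = jK x)
    (hjfix : ∀ z : K, Θ z = z → ∃ x, jK x = z) (hjσ : ∀ x, jK (σ' x) = ρ (jK x)) (hjπ : Valued.v (jK π') = exp (-2 : ℤ))
    {ϖ : K} {dΘ tΘ : ℕ} (hDΘ : IsRamifiedQuadraticDatum Θ ϖ dΘ tΘ)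
    (hFN : ∀ f : K, ρ f = f → Θ f = f → Valued.v f = 1 → ∃ x : K, x * Θ x = f)
    {n₀ : K} (hΘn₀ : Θ n₀ = n₀) (hn₀1 : Valued.v n₀ = 1) (hn₀N : ¬ ∃ z : K, z * Θ z = n₀)
    (hϖE : Valued.v ϖE = exp (-2 : ℤ)) (hρϖ : ρ ϖE = ϖE) {q : ℕ} (hq : Nat.card 𝓀[K] = q) (hq' : Nat.card 𝓀[K'] = q) (hq2 : 2 ∣ q)
    (hΘh : Θ h = h) (hh : h ≠ 0) {vh : ℤ} (hvh : Valued.v h = exp (-vh))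
    (hΘh' : Θ h' = h') (hh' : h' ≠ 0) {vh' : ℤ} (hvh' : Valued.v h' = exp (-vh'))
    {lam u : K} (hlam : lam * Θ lam = 1) (hu : ρ u = u) (hu1 : u * Θ u = 1)
    {m jl : ℕ} (hμ : Valued.v (lam - u) = Valued.v ϖE ^ m) (hjl : Valued.v ((lam - u) - ρ (lam - u)) = Valued.v (ϖE ^ jl * (α - ρ α)))
    {tc : K} (hρt : ρ tc = tc) {eo : ℕ} (hte : Valued.v tc = Valued.v ϖE ^ eo) {m₁ jl₁ : ℕ} (hme : m₁ + eo = m) (hjle' : jl₁ + eo = jl)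
    {g s0 : ℕ} (hg : dΘ = 2 * g) (hs0 : dτ = 2 * s0) (hd' : 2 * d' = dρ + dτ) (hdK2 : 2 * dK = dρ + 2 * g)
    {e e' : ℤ} (he : vh + dρ = 2 * e) (he' : vh' + dρ = 2 * e')
    (hreg : (m + s0 ≤ jl ∧ (m + s0) % 2 = jl % 2) ∨ jl + 1 = m + s0) (hmd : g + s0 ≤ m + 1) (hjlS : 2 * s0 + g ≤ jl + 2)
    (hcls0 : ∀ k₀ : ℤ, Valued.v (1 + ρ h / h * (ρ (α ^ k₀ * Θ (α ^ k₀)) / (α ^ k₀ * Θ (α ^ k₀)))) ≤ exp (-(2 * (d' : ℤ) - 2)))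
    (hclsT : ∀ k₀ : ℤ, (∃ r : ℤ, k₀ + s0 + e = 2 * r) → ∃ ω₀ : Kˣ, Valued.v (ω₀ : K) = 1 ∧
      ρ h / h * (ρ (α ^ k₀ * Θ (α ^ k₀)) / (α ^ k₀ * Θ (α ^ k₀))) * (ρ ((ω₀ : K) * Θ ω₀) / ((ω₀ : K) * Θ ω₀)) = -1)
    (hclsO : ∀ k₀ : ℤ, (∃ r : ℤ, k₀ + s0 + e = 2 * r + 1) → ∀ ω : Kˣ, Valued.v (ω : K) = 1 →
      ¬ Valued.v (1 + ρ h / h * (ρ (α ^ k₀ * Θ (α ^ k₀)) / (α ^ k₀ * Θ (α ^ k₀))) * (ρ ((ω : K) * Θ ω) / ((ω : K) * Θ ω))) ≤ exp (-(2 * (d' : ℤ))))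
    (hcls0' : ∀ k₀ : ℤ, Valued.v (1 + ρ h' / h' * (ρ (α ^ k₀ * Θ (α ^ k₀)) / (α ^ k₀ * Θ (α ^ k₀)))) ≤ exp (-(2 * (d' : ℤ) - 2)))
    (hclsE : ∀ k₀ : ℤ, (∃ r : ℤ, k₀ + s0 + e' = 2 * r) → ∃ ω₀ : Kˣ, Valued.v (ω₀ : K) = 1 ∧
      ρ h' / h' * (ρ (α ^ k₀ * Θ (α ^ k₀)) / (α ^ k₀ * Θ (α ^ k₀))) * (ρ ((ω₀ : K) * Θ ω₀) / ((ω₀ : K) * Θ ω₀)) * (ρ n₀ / n₀) = -1)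
    (hclsO' : ∀ k₀ : ℤ, (∃ r : ℤ, k₀ + s0 + e' = 2 * r + 1) → ∀ ω : Kˣ, Valued.v (ω : K) = 1 →
      ¬ Valued.v (1 + ρ h' / h' * (ρ (α ^ k₀ * Θ (α ^ k₀)) / (α ^ k₀ * Θ (α ^ k₀))) * (ρ ((ω : K) * Θ ω) / ((ω : K) * Θ ω))) ≤ exp (-(2 * (d' : ℤ))))
    {ω_r : Kˣ} (hω_r : Valued.v (ω_r : K) = 1)
    (hrel : ρ h' / h' * (ρ (α ^ ((m : ℤ) - jl - e') * Θ (α ^ ((m : ℤ) - jl - e'))) / (α ^ ((m : ℤ) - jl - e') * Θ (α ^ ((m : ℤ) - jl - e')))) =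
      ρ h / h * (ρ (α ^ ((m : ℤ) - jl - e) * Θ (α ^ ((m : ℤ) - jl - e))) / (α ^ ((m : ℤ) - jl - e) * Θ (α ^ ((m : ℤ) - jl - e)))) * (ρ n₀ / n₀) *
        (ρ ((ω_r : K) * Θ ω_r) / ((ω_r : K) * Θ ω_r)))
    (ε : ℚ)
    (hST : m + s0 ≤ jl → (∃ ω : K, Valued.v ω = 1 ∧
      Valued.v (ρ (lam - u) / (lam - u) * (ρ (ω * Θ ω) / (ω * Θ ω)) - 1) ≤ exp (-(2 * ((s0 : ℤ) + 2 * g - 1) + dρ))) → ε = 1)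
    (hSE : m + s0 ≤ jl → (∃ ω : K, Valued.v ω = 1 ∧
      Valued.v (ρ (lam - u) / (lam - u) * (ρ n₀ / n₀) * (ρ (ω * Θ ω) / (ω * Θ ω)) - 1) ≤ exp (-(2 * ((s0 : ℤ) + 2 * g - 1) + dρ))) → ε = -1)
    (hSP : jl + 1 = m + s0 → (∃ ω₁ : Kˣ, Valued.v (ω₁ : K) = 1 ∧
      Valued.v (1 + ρ h / h * (ρ (α ^ ((m : ℤ) - jl - e) * Θ (α ^ ((m : ℤ) - jl - e))) / (α ^ ((m : ℤ) - jl - e) * Θ (α ^ ((m : ℤ) - jl - e)))) /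
        (ρ (lam - u) / (lam - u)) * (ρ ((ω₁ : K) * Θ ω₁) / ((ω₁ : K) * Θ ω₁))) ≤ exp (-(2 * ((s0 : ℤ) + 2 * g - 1) + dρ))) → ε = 1)
    (hSM : jl + 1 = m + s0 → (∃ ω₁ : Kˣ, Valued.v (ω₁ : K) = 1 ∧
      Valued.v (1 + ρ h' / h' * (ρ (α ^ ((m : ℤ) - jl - e') * Θ (α ^ ((m : ℤ) - jl - e'))) / (α ^ ((m : ℤ) - jl - e') * Θ (α ^ ((m : ℤ) - jl - e')))) /
        (ρ (lam - u) / (lam - u)) * (ρ ((ω₁ : K) * Θ ω₁) / ((ω₁ : K) * Θ ω₁))) ≤ exp (-(2 * ((s0 : ℤ) + 2 * g - 1) + dρ))) → ε = -1) :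
    ∀ j a, j ≤ jl₁ → a ≤ j → ¬ (a ≤ m₁ ∧ (j + a ≤ m₁ ∨ (2 * a ≤ m₁ ∧ j + a ≤ jl₁))) → j + m₁ = jl₁ + a → ¬ (j + a + 2 ≤ m₁ + s0 + 2 * g) →
      (((levelSetDep ρ Θ α ϖE h j a (tc⁻¹ * (lam - u))).ncard : ℚ) =
          if 2 * j + (g + s0) ≤ 2 * jl₁ + 1 + eo ∧ ε = 1 then 2 * (q : ℚ) ^ (j - (j + a - m₁ - s0 + 1) / 2) else 0) ∧
      (((levelSetDep ρ Θ α ϖE h' j a (tc⁻¹ * (lam - u))).ncard : ℚ) =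
          if 2 * j + (g + s0) ≤ 2 * jl₁ + 1 + eo ∧ ε = -1 then 2 * (q : ℚ) ^ (j - (j + a - m₁ - s0 + 1) / 2) else 0) := by
  intro j a hj _ hng hdiag hfar
  obtain ⟨hρρ, -, hα, -, -, -, -⟩ := id hD
  have hΘΘ := hDΘ.1
  have hg1 : 1 ≤ g := by have h1 := hDΘ.2.2.2.2.2.1; omega
  have hα0 : α ≠ 0 := fun h0 => by rw [h0, map_zero] at hα; exact exp_ne_zero hα.symm
  have hΘα0 : ∀ k : ℤ, Θ (α ^ k) ≠ 0 := fun k => (map_ne_zero Θ).2 (zpow_ne_zero k hα0)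
  have hTE : ¬ (ε = 1 ∧ ε = -1) := fun h1 => by rw [h1.1] at h1; norm_num at h1
  obtain ⟨hμ₁, hjl₁, hκ⟩ := tokens_inv_mul (ρ := ρ) (α := α) hϖE hμ hjl hρt hte hme hjle'
  have hk₀ : vh + dρ + 2 * ((m : ℤ) - jl - e) + 2 * jl₁ = 2 * m₁ := by omega
  have hk₀' : vh' + dρ + 2 * ((m : ℤ) - jl - e') + 2 * jl₁ = 2 * m₁ := by omega
  have hrad : (2 * (m₁ : ℤ) - 2 * a - 2 * j - dρ) = -(2 * ((j + a - m₁ : ℕ) : ℤ) + dρ) := by omega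
  have hlt : ¬ (j + a < m₁ + s0) := by omega
  have h2g : 2 * g ≤ j + a - m₁ - s0 + 1 := by omega
  -- the value of a far cell of `μ₁` from its bit (★ (V), μ-generic), given the bit's law in the offset form
  have hfin : ∀ (s : K) (hs : s ≠ 0) {vs : ℤ} (hvs : Valued.v s = exp (-vs)) {es : ℤ} (hks : vs + dρ + 2 * ((m : ℤ) - jl - es) + 2 * jl₁ = 2 * m₁) (Side : Prop) [Decidable Side],
      ((∃ ω₁ : Kˣ, Valued.v (ω₁ : K) = 1 ∧
        Valued.v (1 + ρ s / s * (ρ (α ^ ((m : ℤ) - jl - es) * Θ (α ^ ((m : ℤ) - jl - es))) / (α ^ ((m : ℤ) - jl - es) * Θ (α ^ ((m : ℤ) - jl - es)))) /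
          (ρ (tc⁻¹ * (lam - u)) / (tc⁻¹ * (lam - u))) * (ρ ((ω₁ : K) * Θ ω₁) / ((ω₁ : K) * Θ ω₁))) ≤ exp (2 * (m₁ : ℤ) - 2 * a - 2 * j - dρ)) ↔
        2 * j + (g + s0) ≤ 2 * jl₁ + 1 + eo ∧ (j + a + 2 ≤ m₁ + s0 + 2 * g ∨ Side)) →
      ((levelSetDep ρ Θ α ϖE s j a (tc⁻¹ * (lam - u))).ncard : ℚ) =
        if 2 * j + (g + s0) ≤ 2 * jl₁ + 1 + eo ∧ Side then 2 * (q : ℚ) ^ (j - (j + a - m₁ - s0 + 1) / 2) else 0 := by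
    intro s hs vs hvs es hks Side _ hbit
    rw [ncard_levelSetDep_top_cast_eq_of_bit hD hΘρ hvΘ hϖE hρϖ hq hq' hq2 hσ' hvσ' hfix' hπ' hdd' jK hjle hjΘ hjfix hjσ hjπ hDΘ hFN hs hvs hμ₁ hjl₁ hg hs0 hd'
      hks hj hng hdiag _ hbit, if_neg hlt, if_pos h2g]
    by_cases hb : 2 * j + (g + s0) ≤ 2 * jl₁ + 1 + eo ∧ Side
    · rw [if_pos hb, if_pos ⟨hb.1, Or.inr hb.2⟩]
    · rw [if_neg hb, if_neg (fun h2 => hb ⟨h2.1, h2.2.resolve_left hfar⟩)]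
  rcases hreg with ⟨hA, hpar⟩ | hoff
  · ---------------------------------------------------------------- regime A: even-class diagonal (translator ∕ anchor), law at the radius letter `c = j + a − m₁`
    obtain ⟨ω₀, hω₀, hη⟩ := hclsT ((m : ℤ) - jl - e) ⟨((m : ℤ) + s0 - jl) / 2, by omega⟩
    obtain ⟨ω₀', hω₀', hη'⟩ := hclsE ((m : ℤ) - jl - e') ⟨((m : ℤ) + s0 - jl) / 2, by omega⟩
    refine ⟨hfin h hh hvh hk₀ (ε = 1) ?_, hfin h' hh' hvh' hk₀' (ε = -1) ?_⟩
    · rw [topBit_iff_twistNear_ramified hD hvΘ hϖE hω₀ hη hμ₁ j a, hκ, hrad,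
        twistNear_iff_censusBit hD hΘρ hvΘ hτ hDτ hτP hP hdK hσ' hvσ' hfix' hπ' hdd' jK hjle hjΘ hjfix hjσ hjπ hDΘ hFN hΘn₀ hn₀1 hn₀N hϖE hlam hu hu1 hμ hjl
          hg hs0 hd' hdK2 (Or.inl hA) hjlS (ε = 1) (ε = -1) (hST hA) (hSE hA) hTE (j + a - m₁)]
      constructor <;> rintro ⟨h1, h2⟩ <;> exact ⟨by omega, h2.imp_left fun h3 => by omega⟩
    · rw [topBit_iff_anchoredNear_ramified hD hvΘ hϖE hω₀' hn₀1 hη' hμ₁ j a, hκ, hrad,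
        anchoredNear_iff_censusBit hD hΘρ hvΘ hτ hDτ hτP hP hdK hσ' hvσ' hfix' hπ' hdd' jK hjle hjΘ hjfix hjσ hjπ hDΘ hFN hΘn₀ hn₀1 hn₀N hϖE hlam hu hu1 hμ hjl
          hg hs0 hd' hdK2 (Or.inl hA) hjlS (ε = 1) (ε = -1) (hST hA) (hSE hA) hTE (j + a - m₁)]
      constructor <;> rintro ⟨h1, h2⟩ <;> exact ⟨by omega, h2.imp_left fun h3 => by omega⟩
  · ---------------------------------------------------------------- regime B: odd-class diagonal (`jl + 1 = m + s0`)
    have hodd := hclsO ((m : ℤ) - jl - e) ⟨0, by omega⟩ 1 (by rw [Units.val_one, Valuation.map_one])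
    have hodd' := hclsO' ((m : ℤ) - jl - e') ⟨0, by omega⟩ 1 (by rw [Units.val_one, Valuation.map_one])
    simp only [Units.val_one, map_one, div_one, mul_one] at hodd hodd'
    have hΘη := theta_classMult (α := α) hΘΘ hΘρ hΘh ((m : ℤ) - jl - e)
    have hη1 := classMult_mul_map (Θ := Θ) hρρ hh hα0 hΘα0 ((m : ℤ) - jl - e)
    have hΘη' := theta_classMult (α := α) hΘΘ hΘρ hΘh' ((m : ℤ) - jl - e')
    have hη'1 := classMult_mul_map (Θ := Θ) hρρ hh' hα0 hΘα0 ((m : ℤ) - jl - e')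
    have hn₀0 : n₀ ≠ 0 := fun h0 => by rw [h0, map_zero] at hn₀1; exact zero_ne_one hn₀1
    have hη0 : ρ h / h * (ρ (α ^ ((m : ℤ) - jl - e) * Θ (α ^ ((m : ℤ) - jl - e))) / (α ^ ((m : ℤ) - jl - e) * Θ (α ^ ((m : ℤ) - jl - e)))) ≠ 0 :=
      left_ne_zero_of_mul_eq_one hη1
    obtain ⟨ω', hω', hrel'⟩ := rel_symm_of_rel (Θ := Θ) hΘn₀ hn₀0 hn₀1 hω_r hη0 hrel
    have hTE' : ¬ (ε = -1 ∧ ε = 1) := fun h1 => hTE ⟨h1.2, h1.1⟩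
    refine ⟨hfin h hh hvh hk₀ (ε = 1) ?_, hfin h' hh' hvh' hk₀' (ε = -1) ?_⟩
    · rw [hκ, hrad, oddBit_iff_censusBit hD hΘρ hvΘ hτ hDτ hτP hP hdK hσ' hvσ' hfix' hπ' hdd' jK hjle hjΘ hjfix hjσ hjπ hDΘ hFN hΘn₀ hn₀1 hn₀N hϖE hlam hu hu1 hμ hjl
        hg hs0 hd' hdK2 hoff hmd hΘη hη1 (hcls0 _) hodd hω_r hrel (ε = 1) (ε = -1) (hSP hoff) (hSM hoff) hTE (j + a - m₁)]
      constructor <;> rintro ⟨h1, h2⟩ <;> exact ⟨by omega, h2.imp_left fun h3 => by omega⟩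
    · rw [hκ, hrad, oddBit_iff_censusBit hD hΘρ hvΘ hτ hDτ hτP hP hdK hσ' hvσ' hfix' hπ' hdd' jK hjle hjΘ hjfix hjσ hjπ hDΘ hFN hΘn₀ hn₀1 hn₀N hϖE hlam hu hu1 hμ hjl
        hg hs0 hd' hdK2 hoff hmd hΘη' hη'1 (hcls0' _) hodd' hω' hrel' (ε = -1) (ε = 1) (hSM hoff) (hSP hoff) hTE' (j + a - m₁)]
      constructor <;> rintro ⟨h1, h2⟩ <;> exact ⟨by omega, h2.imp_left fun h3 => by omega⟩

end Summit.HodgeConjecture.HodgeConjecture.Cruxes.H413.F0P3cDyRamToricLevelCensusRamM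

end
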